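import Mathlib
import Summits.PneNP.PneNP.Theorems.ConvexRankGatesCaptureSignCertDefs

/-!
# Crux `Capture` (stmt-PneNP-2659) — SIGN CERTIFICATES for the dual-PERM door are SOUND, and the sign on a
# colour class is `𝔽₂`-LINEAR in the colouring (lead c10)

Support theorems for the crux `Summit.PneNP.PneNP.Theses.ConvexRankGates.Capture`; objects from
`ConvexRankGatesCaptureSignCertDefs.lean`.

* `not_mem_closure_of_sign` — group form: if every available generator is `x`-invariant and EVEN on `B = {x = 1}`
  while `τ` is `x`-invariant and ODD on `B`, then `τ ∉ ⟨available generators⟩` (they lie in `certSubgroup x`, a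
  subgroup: restriction to `B` is a homomorphism on the stabiliser of the colouring).
* `sign_onB_eq` — the sign of `g` on `B` is `(-1)^{sgnRow g ⬝ᵥ x}`: `supp (onB x g) = supp g ∩ B` and the cycle
  factors of `onB x g` are the cycle factors of `g` inside `B` (cycles of an `x`-invariant `g` are monochromatic),
  then `sign = (-1)^{Σ cycleType + #cycleType}` (Mathlib).
* `signTest_sound` (registered anchor) — **`SignTest σ τ v → τ ∉ ⟨σ_i : v_i = 0⟩`**: the level-1 sign test is a
  sound MONOTONE certificate for the dual-PERM function.
* `signTest_A3` — it is not subsumed by orbit tests: generator `(0 1 2)` (transitive `A₃`), target `(0 1)`, the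
  test fires with nothing removed.

The one-gate realisation (`signTest_circuit`: ONE PERM gate) is `ConvexRankGatesCaptureSignCertGate.lean`.
No new definitions. [folklore]
-/

namespace Summit.PneNP.PneNP.Theorems.Capture.SignCert

set_option linter.dupNamespace false -- `Summit.PneNP.PneNP.…`: summit = sub-problem (D-0017)

open Equiv Equiv.Perm Finset

variable {d : ℕ}

/-- **Soundness of sign certificates, group form**: if every available generator is `x`-invariant and even on
`{x = 1}` while `τ` is `x`-invariant and ODD on `{x = 1}`, then `τ` is not generated. [folklore] -/
theorem not_mem_closure_of_sign {n : ℕ} (σ : Fin n → Perm (Fin d)) (τ : Perm (Fin d)) (S : Set (Fin n))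
    (x : Fin d → ZMod 2) (hτ : ∀ p, x (τ p) = x p) (hsτ : sign (onB x τ hτ) = -1)
    (hσ : ∀ i ∈ S, ∃ hx : ∀ p, x (σ i p) = x p, sign (onB x (σ i) hx) = 1) :
    τ ∉ Subgroup.closure (σ '' S) := by
  intro hmem
  have hle : Subgroup.closure (σ '' S) ≤ certSubgroup x := by
    rw [Subgroup.closure_le]
    rintro _ ⟨i, hi, rfl⟩
    exact hσ i hi
  obtain ⟨hτ', hs⟩ := hle hmem
  have : sign (onB x τ hτ) = 1 := hs
  rw [this] at hsτ
  exact absurd hsτ (by decide)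

/-! ### The sign on `{x = 1}` is an `𝔽₂`-LINEAR function of the colouring -/

/-! ### The sign on `{x = 1}` is an `𝔽₂`-LINEAR function of the colouring -/

/-- Cycles of an `x`-invariant permutation are monochromatic. [folklore] -/
theorem mono_of_mem_cycleFactorsFinset {x : Fin d → ZMod 2} {g : Perm (Fin d)} (hx : ∀ p, x (g p) = x p)
    {c : Perm (Fin d)} (hc : c ∈ g.cycleFactorsFinset) {a b : Fin d} (ha : a ∈ c.support) (hb : b ∈ c.support) :
    x a = x b := by
  rw [mem_cycleFactorsFinset_iff] at hc
  have step : ∀ a' ∈ c.support, x (c a') = x a' := fun a' ha' => by rw [hc.2 a' ha', hx]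
  have hpow : ∀ (k : ℕ) (a' : Fin d), a' ∈ c.support → x ((c ^ k) a') = x a' := by
    intro k
    induction k with
    | zero => intro a' _; rfl
    | succ k ih =>
      intro a' ha'
      rw [pow_succ', Perm.mul_apply, step _ (pow_apply_mem_support.2 ha'), ih a' ha']
  obtain ⟨k, hk⟩ := hc.1.exists_pow_eq (mem_support.1 ha) (mem_support.1 hb)
  rw [← hk, hpow k a ha]

/-- The support of `onB x g` is `supp g ∩ {x = 1}`. [folklore] -/
theorem support_onB (x : Fin d → ZMod 2) (g : Perm (Fin d)) (hx : ∀ p, x (g p) = x p) :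
    (onB x g hx).support = g.support.filter fun p => x p = 1 := by
  ext p
  simp only [mem_support, onB_apply, Finset.mem_filter]
  by_cases hp : x p = 1 <;> simp [hp]

/-- The cycle factors of `onB x g` are the cycle factors of `g` inside `{x = 1}`. [folklore] -/
theorem cycleFactorsFinset_onB (x : Fin d → ZMod 2) (g : Perm (Fin d)) (hx : ∀ p, x (g p) = x p) :
    (onB x g hx).cycleFactorsFinset = g.cycleFactorsFinset.filter fun c => ∀ a ∈ c.support, x a = 1 := by
  ext c
  simp only [Finset.mem_filter, mem_cycleFactorsFinset_iff]
  constructor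
  · rintro ⟨hc, hcg⟩
    have hB : ∀ a ∈ c.support, x a = 1 := by
      intro a ha
      by_contra hxa
      have h1 := hcg a ha
      rw [onB_apply, if_neg hxa] at h1
      exact (mem_support.1 ha) h1
    refine ⟨⟨hc, fun a ha => ?_⟩, hB⟩
    rw [hcg a ha, onB_apply, if_pos (hB a ha)]
  · rintro ⟨⟨hc, hcg⟩, hB⟩
    refine ⟨hc, fun a ha => ?_⟩
    rw [hcg a ha, onB_apply, if_pos (hB a ha)]

/-- Dot product with an indicator is the sum over the set. [folklore] -/
theorem dotProduct_indicator (s : Finset (Fin d)) (x : Fin d → ZMod 2) :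
    (fun p => if p ∈ s then (1 : ZMod 2) else 0) ⬝ᵥ x = ∑ p ∈ s, x p := by
  simp only [dotProduct, ite_mul, one_mul, zero_mul, Finset.sum_ite_mem, Finset.univ_inter]

/-- Dot product with the cycle-count row is the sum over the least points of the cycles. [folklore] -/
theorem dotProduct_cycRow (g : Perm (Fin d)) (x : Fin d → ZMod 2) :
    cycRow g ⬝ᵥ x = ∑ c ∈ g.cycleFactorsFinset.attach,
      x (c.1.support.min' (support_nonempty_of_mem_cycleFactorsFinset c.2)) := by
  unfold cycRow
  rw [sum_dotProduct]
  refine Finset.sum_congr rfl fun c _ => ?_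
  rw [single_dotProduct, one_mul]

/-- **The sign on `B` is linear in the colouring**: for an `x`-invariant `g`, the exponent of
`sign (onB x g)` is `sgnRow g ⬝ᵥ x`. [folklore] -/
theorem sign_onB_eq (x : Fin d → ZMod 2) (g : Perm (Fin d)) (hx : ∀ p, x (g p) = x p) :
    ∃ m : ℕ, sign (onB x g hx) = (-1) ^ m ∧ (m : ZMod 2) = sgnRow g ⬝ᵥ x := by
  have ite_eq_self : ∀ a : ZMod 2, (if a = 1 then (1 : ZMod 2) else 0) = a := by decide
  refine ⟨(onB x g hx).cycleType.sum + Multiset.card (onB x g hx).cycleType, sign_of_cycleType _, ?_⟩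
  rw [sum_cycleType, cycleType_def, Multiset.card_map, Finset.card_val, support_onB, cycleFactorsFinset_onB,
    Nat.cast_add, sgnRow, add_dotProduct, dotProduct_indicator, dotProduct_cycRow]
  congr 1
  · rw [Finset.card_filter, Nat.cast_sum]
    refine Finset.sum_congr rfl fun p _ => ?_
    rw [Nat.cast_ite, Nat.cast_one, Nat.cast_zero, ite_eq_self]
  · rw [Finset.card_filter, Nat.cast_sum, ← Finset.sum_attach]
    refine Finset.sum_congr rfl fun c _ => ?_
    have hmin := Finset.min'_mem c.1.support (support_nonempty_of_mem_cycleFactorsFinset c.2)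
    rw [Nat.cast_ite, Nat.cast_one, Nat.cast_zero, ← ite_eq_self (x _)]
    congr 1
    refine propext ⟨fun h => h _ hmin, fun h a ha => ?_⟩
    rw [mono_of_mem_cycleFactorsFinset hx c.2 ha hmin, h]

/-- `sgnRow g ⬝ᵥ x = 0`: `g` is EVEN on `{x = 1}`. [folklore] -/
theorem sign_onB_of_dotProduct_eq_zero {x : Fin d → ZMod 2} {g : Perm (Fin d)} (hx : ∀ p, x (g p) = x p)
    (h : sgnRow g ⬝ᵥ x = 0) : sign (onB x g hx) = 1 := by
  obtain ⟨m, hm, hmx⟩ := sign_onB_eq x g hx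
  rw [h, ZMod.natCast_eq_zero_iff_even] at hmx
  rw [hm]
  exact hmx.neg_one_pow

/-- `sgnRow g ⬝ᵥ x = 1`: `g` is ODD on `{x = 1}`. [folklore] -/
theorem sign_onB_of_dotProduct_eq_one {x : Fin d → ZMod 2} {g : Perm (Fin d)} (hx : ∀ p, x (g p) = x p)
    (h : sgnRow g ⬝ᵥ x = 1) : sign (onB x g hx) = -1 := by
  obtain ⟨m, hm, hmx⟩ := sign_onB_eq x g hx
  rw [h, ZMod.natCast_eq_one_iff_odd] at hmx
  rw [hm]
  exact hmx.neg_one_pow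

/-! ### The sign test -/

/-- **Sign certificates are sound** (registered anchor): `SignTest σ τ v → τ ∉ ⟨σ_i : v_i = 0⟩`. [folklore] -/
theorem signTest_sound : ∀ {d n : ℕ} {σ : Fin n → Equiv.Perm (Fin d)} {τ : Equiv.Perm (Fin d)} {v : Fin n → Bool},
    SignTest σ τ v → τ ∉ Subgroup.closure (σ '' {i | v i = false}) := by
  intro d n σ τ v h
  obtain ⟨x, hτ, hsτ, hσ⟩ := h
  refine not_mem_closure_of_sign σ τ _ x hτ (sign_onB_of_dotProduct_eq_one hτ hsτ) fun i hi => ?_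
  obtain ⟨hxi, hsi⟩ := hσ i hi
  exact ⟨hxi, sign_onB_of_dotProduct_eq_zero hxi hsi⟩

/-- The sign test is monotone in the selection (removing generators only helps). [folklore] -/
theorem SignTest.mono {n : ℕ} {σ : Fin n → Perm (Fin d)} {τ : Perm (Fin d)} {v w : Fin n → Bool}
    (hvw : v ≤ w) (h : SignTest σ τ v) : SignTest σ τ w := by
  obtain ⟨x, hτ, hsτ, hσ⟩ := h
  refine ⟨x, hτ, hsτ, fun i hi => hσ i ?_⟩
  have := hvw i
  rw [hi] at this
  revert this
  cases v i <;> simp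

/-- **The test is not subsumed by orbit tests**: on `3` points with the single generator `(0 1 2)` (generating
the TRANSITIVE group `A₃`) and target the transposition `(0 1)`, the sign test fires with no generator removed
(colouring `x ≡ 1`), although `τ` preserves the unique orbit. [folklore] -/
theorem signTest_A3 : SignTest (d := 3) (fun _ : Fin 1 => swap 0 1 * swap 1 2) (swap 0 1) (fun _ => false) := by
  refine ⟨fun _ => 1, fun _ => rfl, ?_, fun i _ => ⟨fun _ => rfl, ?_⟩⟩
  · decide
  · fin_cases i
    decide


end Summit.PneNP.PneNP.Theorems.Capture.SignCert
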